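import Summits.ResolutionOfSingularities.ResolutionOfSingularities.Theorems.FrobeniusClosingPatchingRelPerfectDepthOneTargetsDefs
import Summits.ResolutionOfSingularities.ResolutionOfSingularities.Theorems.FrobeniusClosingPatchingRelPerfectDepthOneBlowupDimension
import Literature.AlgebraicGeometry.Resolution.RegularCentreBlowupSeqIntegral
import Literature.AlgebraicGeometry.Resolution.RegularBlowup
import Literature.AlgebraicGeometry.Resolution.RetractionBlowupTransform
import Literature.AlgebraicGeometry.Resolution.SigmaMaxEliminationInDim
import Literature.AlgebraicGeometry.Resolution.ArithmeticalThreefoldsBlowupFormDimThree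
import HarnessLib

/-!
# Crux `PatchingRelPerfect` (stmt-ResolutionOfSingularities-16161), chain w52 — programme r-d1,
# piece A1: CONTROLLED PRINCIPALIZATION on regular excellent threefolds (`PrincipalizeControlled`)

[OURS · L1 W5.2 · r-d1 A1] CHAIN v1.5 §2 / plan-1's typed targets E
(`Theorems/FrobeniusClosingPatchingRelPerfectDepthOneTargetsDefs.lean`, decl
`DepthOneTargets.PrincipalizeControlled`, proved here BY NAME as `DepthOne.principalizeControlled_holds`):
on a regular, excellent, integral Noetherian threefold `E`, Cossart–Piltant's principalization (the
NAMED FACT `CossartPiltant2019Principalization`, CP 2019 Prop. 4.4 = F-31, taken as a HYPOTHESIS —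
the theorem is conditional on it exactly as the typed target is) carries every non-zero ideal sheaf
`𝔟` by a CONTROLLED sequence (`DepthOneTargets.IsControlledSeq`: regular centres `C_j ⊇ 𝔟_j`,
`𝔟_{j+1}` the controlled transform, `𝔟_j𝒪 = C_j𝒪 · 𝔟_{j+1}`) to a non-zero LOCALLY PRINCIPAL ideal
sheaf, the last threefold being again regular, excellent, integral, Noetherian of dimension three.

Proof (`DepthOne.isControlledSeq_of_isRegularCentreBlowupSeq`, induction on CP's
`IsRegularCentreBlowupSeq σ 𝔟` carrying the FORMAT `𝔟𝒪_{E_j} = M_j · 𝔟_j` with `M_j` locally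
principal — the product of the pulled-back exceptional ideals): CP's centre `Y_j` lies in the
non-locally-principal locus of the TOTAL transform `𝔟𝒪_{E_j}`, which is contained in that of `𝔟_j`
(`IsLocallyPrincipalAt.mul`: `M_j` is locally principal) and hence in `Supp 𝔟_j`
(`nonPrincipalLocus_le_support`), so `𝔟_j ≤ 𝓘(Y_j)` (`le_support_iff_le_vanishingIdeal`) and
`𝔟_j𝒪 = 𝓘(Y_j)𝒪 · 𝔟_{j+1}` (`IsBlowup.comap_mul_controlledTransform_one`); integrality
(`IsBlowup.isIntegral`), Noetherianity (blowing ups are proper), regularity (Liu 8.1.19 (a),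
`IsBlowup.isRegular_of_isRegular_subscheme`), excellence (finite type over excellent,
`Scheme.IsExcellent.of_locallyOfFiniteType`) and dimension three
(`DepthOne.topologicalKrullDim_eq_of_isBlowup`) persist. At the end `𝔟𝒪 = M · 𝔟'` is locally
principal with `M ≠ 0` locally principal on an integral scheme, i.e. an effective Cartier divisor
(`IsLocallyPrincipal.isEffectiveCartier_of_ne_bot`), which cancels
(`DepthOne.isLocallyPrincipal_of_isEffectiveCartier_mul`). Nothing here is a statement of the
manuscript under review; the result is CONDITIONAL on the named fact F-31 by design of the target.

## References

* V. Cossart, O. Piltant, J. Algebra 529 (2019), Prop. 4.4 (arXiv:1412.0868 v1 Prop. 4.3).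
  [CossartPiltant2019]
* Q. Liu, *Algebraic Geometry and Arithmetic Curves* (2002), Thm. 8.1.19 (a). [Liu2002]
* J. Kollár, *Lectures on Resolution of Singularities* (2007), (3.111) Step 3. [Kollar2007]
-/

-- `Summit.<Summit>.<Sub>.Theorems` with `Sub = Summit` (single-conjunct summit, D-0017)
set_option linter.dupNamespace false

noncomputable section

open CategoryTheory CategoryTheory.Limits AlgebraicGeometry TopologicalSpace
open Literature.AlgebraicGeometry.Resolution Scheme.IdealSheafData

namespace Summit.ResolutionOfSingularities.ResolutionOfSingularities.Theorems

universe u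

namespace DepthOne

open DepthOneTargets

/-- **The format along a Cossart–Piltant principalizing sequence.** Along
`IsRegularCentreBlowupSeq σ J` over an integral Noetherian regular excellent scheme of dimension
three with `J ≠ 0`: the sequence is a CONTROLLED sequence for `J` (each centre
`Y_j ⊆ NonPrinc(J𝒪) ⊆ NonPrinc(𝔟_j) ⊆ Supp 𝔟_j`, so `𝔟_j ≤ 𝓘(Y_j)`; `𝔟_{j+1}` the controlled
transform), with the FORMAT `J𝒪_{S'} = M · 𝔟'`, `M` locally principal (the product of the
pulled-back exceptional ideals), and `S'` is again integral, Noetherian, regular (Liu 8.1.19 (a)),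
excellent (finite type over excellent) of dimension three (`topologicalKrullDim_eq_of_isBlowup`).
[cite: CossartPiltant2019, Prop. 4.4 (i)] [cite: Kollar2007, (3.111) Step 3] -/
theorem isControlledSeq_of_isRegularCentreBlowupSeq {S' S : Scheme.{u}} {σ : S' ⟶ S}
    {J : S.IdealSheafData} (h : IsRegularCentreBlowupSeq σ J) :
    IsIntegral S → IsNoetherian S → Scheme.IsRegular S → Scheme.IsExcellent S →
    topologicalKrullDim S = (3 : ℕ) → J ≠ ⊥ →
    ∃ (𝔟' M : S'.IdealSheafData), IsControlledSeq σ J 𝔟' ∧ J.comap σ = M * 𝔟' ∧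
      IsLocallyPrincipal M ∧ IsIntegral S' ∧ IsNoetherian S' ∧ Scheme.IsRegular S' ∧
      Scheme.IsExcellent S' ∧ topologicalKrullDim S' = (3 : ℕ) := by
  induction h with
  | nil J =>
    intro hint hN hreg hexc hdim hJ
    refine ⟨J, ⊤, IsControlledSeq.nil J, ?_, isLocallyPrincipal_top _, hint, hN, hreg, hexc, hdim⟩
    rw [Scheme.IdealSheafData.comap_id, ← Scheme.IdealSheafData.one_eq_top, one_mul]
  | @cons S'' S' S τ σ J Y hσ hYint hYreg hY hτ ih =>
    intro hint hN hreg hexc hdim hJ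
    obtain ⟨𝔟, M, hseq, hfmt, hM, hint', hN', hreg', hexc', hdim'⟩ := ih hint hN hreg hexc hdim hJ
    haveI := hint'
    haveI := hN'
    haveI : IsProper τ := hτ.isProper
    have hJ' : J.comap σ ≠ ⊥ := (hσ.isIntegral_and_comap_ne_bot hint inferInstance hJ).2.2
    -- the centre condition: `Y ⊆ NonPrinc(J𝒪) ⊆ NonPrinc(𝔟) ⊆ Supp 𝔟`, so `𝔟 ≤ 𝓘(Y)`
    have hYsupp : Y ≤ 𝔟.support := fun y hy =>
      nonPrincipalLocus_le_support 𝔟 (show y ∈ nonPrincipalLocus 𝔟 from fun h𝔟y =>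
        hY y hy (by rw [hfmt]; exact (hM y).mul h𝔟y))
    have hle : 𝔟 ≤ vanishingIdeal Y := le_support_iff_le_vanishingIdeal.mp hYsupp
    -- the centre is a proper non-empty closed subset: `𝓘(Y) ≠ 0`
    have hYtop : (vanishingIdeal Y).support ≠ ⊤ := by
      intro htop
      apply nonPrincipalLocus_ne_top hJ'
      rw [eq_top_iff]
      intro y _
      have hy : y ∈ (Y : Set S') := by
        rw [← Scheme.IdealSheafData.coe_support_vanishingIdeal Y, htop]
        trivial
      exact hY y hy
    have hC0 : vanishingIdeal Y ≠ ⊥ := fun h =>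
      hYtop (by rw [h, Scheme.IdealSheafData.support_bot])
    have hctrl : 𝔟.comap τ = (vanishingIdeal Y).comap τ *
        controlledTransform τ (vanishingIdeal Y) 𝔟 1 :=
      (hτ.comap_mul_controlledTransform_one hle).symm
    haveI : IsLocallyNoetherian S'' := LocallyOfFiniteType.isLocallyNoetherian τ
    haveI : CompactSpace S'' := QuasiCompact.compactSpace_of_compactSpace τ
    refine ⟨controlledTransform τ (vanishingIdeal Y) 𝔟 1, M.comap τ * (vanishingIdeal Y).comap τ,
      IsControlledSeq.cons τ σ J 𝔟 _ (vanishingIdeal Y) hseq hYreg hle hτ hctrl, ?_, ?_,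
      hτ.isIntegral hC0, {}, hτ.isRegular_of_isRegular_subscheme hreg' hYreg,
      Scheme.IsExcellent.of_locallyOfFiniteType τ hexc',
      topologicalKrullDim_eq_of_isBlowup hτ hC0 hdim'⟩
    · rw [Scheme.IdealSheafData.comap_comp, hfmt, comap_mul, hctrl, mul_assoc]
    · exact (hM.comap τ).mul hτ.isEffectiveCartier.isLocallyPrincipal

/-- **A1 — controlled principalization** (`DepthOneTargets.PrincipalizeControlled`, verbatim
binder shape): on a regular, excellent, integral Noetherian threefold, Cossart–Piltant's
principalization (NAMED FACT `CossartPiltant2019Principalization`, Prop. 4.4, as a hypothesis)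
carries every non-zero ideal sheaf by a controlled sequence to a non-zero LOCALLY PRINCIPAL ideal
sheaf (`J𝒪 = M · 𝔟'` with `M` an effective Cartier divisor, cancelled by
`isLocallyPrincipal_of_isEffectiveCartier_mul`), the last threefold again regular, excellent,
integral, Noetherian of dimension three. [cite: CossartPiltant2019, Prop. 4.4]
[cite: Kollar2007, (3.111) Step 3] -/
theorem principalizeControlled (hCP : CossartPiltant2019Principalization.{u})
    (E : Scheme.{u}) [IsIntegral E] [IsNoetherian E] (hreg : Scheme.IsRegular E)
    (hexc : Scheme.IsExcellent E) (hdim : topologicalKrullDim E = 3) (𝔟 : E.IdealSheafData)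
    (h𝔟 : 𝔟 ≠ ⊥) :
    ∃ (E' : Scheme.{u}) (ρ : E' ⟶ E) (𝔟' : E'.IdealSheafData),
      IsControlledSeq ρ 𝔟 𝔟' ∧ IsLocallyPrincipal 𝔟' ∧ 𝔟' ≠ ⊥ ∧
      IsIntegral E' ∧ IsNoetherian E' ∧ Scheme.IsRegular E' ∧ Scheme.IsExcellent E' ∧
      topologicalKrullDim E' = 3 := by
  have hdim3 : topologicalKrullDim E = (3 : ℕ) := by rw [hdim]; norm_cast
  obtain ⟨E', ρ, hρ, hlp⟩ := hCP E hreg hexc hdim 𝔟 h𝔟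
  obtain ⟨𝔟', M, hseq, hfmt, hM, hint', hN', hreg', hexc', hdim'⟩ :=
    isControlledSeq_of_isRegularCentreBlowupSeq hρ inferInstance inferInstance hreg hexc hdim3 h𝔟
  haveI := hint'
  have hJ' : 𝔟.comap ρ ≠ ⊥ := (hρ.isIntegral_and_comap_ne_bot inferInstance inferInstance h𝔟).2.2
  have hM0 : M ≠ ⊥ := fun h => hJ' (by
    rw [hfmt, h, ← Scheme.IdealSheafData.zero_eq_bot, zero_mul])
  have h𝔟'0 : 𝔟' ≠ ⊥ := fun h => hJ' (by
    rw [hfmt, h, ← Scheme.IdealSheafData.zero_eq_bot, mul_zero])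
  have hMc : IsEffectiveCartier M := hM.isEffectiveCartier_of_ne_bot hM0
  refine ⟨E', ρ, 𝔟', hseq, isLocallyPrincipal_of_isEffectiveCartier_mul hMc (hfmt ▸ hlp), h𝔟'0,
    hint', hN', hreg', hexc', ?_⟩
  rw [hdim']; norm_cast

/-- **A1 BY NAME**: plan-1's typed target `DepthOneTargets.PrincipalizeControlled` (targets E,
9d67ec503d849faa; tree `…DepthOneTargetsDefs.lean`) holds. [cite: CossartPiltant2019, Prop. 4.4] -/
theorem principalizeControlled_holds : DepthOneTargets.PrincipalizeControlled.{u} :=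
  fun hCP E _ _ hreg hexc hdim 𝔟 h𝔟 => principalizeControlled hCP E hreg hexc hdim 𝔟 h𝔟

end DepthOne

/-- **A1 BY NAME in the targets namespace** (res-L1-w52-lead-2 RULING 2 naming, 2026-08-27:
`theorem <lowerCamelDecl>_holds : DepthOneTargets.<Decl>` in `…Theorems.DepthOneTargets`): alias of
`DepthOne.principalizeControlled_holds` for the assembler `depthOne_of_targets'`.
[cite: CossartPiltant2019, Prop. 4.4] -/
theorem DepthOneTargets.principalizeControlled_holds : DepthOneTargets.PrincipalizeControlled.{u} :=
  DepthOne.principalizeControlled_holds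

end Summit.ResolutionOfSingularities.ResolutionOfSingularities.Theorems

end
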